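import Literature.Geometry.Lorentzian.SpacetimeLocalConvergenceOfChartsExhaustionFar
import Literature.Geometry.Lorentzian.TameChartCompactness
import Literature.Analysis.Calculus.SmoothArzelaAscoliExhaustion
import HarnessLib

/-!
# Local Cheeger–Gromov compactness for charts good on an exhaustion

Twin of `TameChartCompactness.lean` (`Spacetime.exists_nearMinkowskiChart_subconvergesLocallyTo`)
for chart maps `Ψₙ : ↥O → 𝓢ₙ` that are smooth, injective, `C⁰`-pinched and `Cᵏ`-bounded (every `k`,
uniformly in `n`) only on the piece over `W n`, where `W 0 ≤ W 1 ≤ ⋯` are preconnected open subsets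
of the connected open `O` containing the centre `y₀` and exhausting `O` — the situation of the time
translates `Φ(· + tₙ ∂₀)` of a chart `Φ` defined for `t > t₀` only (`tₙ → ∞`), whose good pieces
`{t > t₀ − tₙ}` exhaust the eternal cylinder. Conclusion as there: a near-Minkowski limit field `G`
on ALL of `O` (smooth, `‖G − η‖ ≤ θ`, inheriting the `Cᵏ` bounds), `C^∞_loc` convergence of the
deviations along a subsequence, and `(𝓢ₙ, pₙ) ⇀ ((O, G, ∂₀), y₀)` for every `k`
(`Spacetime.exists_nearMinkowskiChart_subconvergesLocallyTo_of_exhaustion`). Analytic input: the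
`C^∞` Arzelà–Ascoli theorem on an exhaustion (`SmoothArzelaAscoliExhaustion.lean`); geometric input:
`LocalSubconvergence.ofChartsExhaustion`.

## References
* P. Petersen, *Riemannian Geometry*, 2nd ed., GTM 171, Springer 2006, Ch. 10, §3.2. [Petersen2006]
-/

noncomputable section

open Set Metric Filter Topology Function TopologicalSpace
open scoped Manifold ContDiff Topology ENNReal

universe u

namespace Literature.Geometry.Lorentzian

open Literature.Analysis.Calculus

section Limits

variable {F : Type*} [NormedAddCommGroup F] [NormedSpace ℝ F]

/-- An eventual bound on a convergent sequence of forms bounds the limit. [folklore] -/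
theorem norm_le_of_tendsto_of_eventually {A : ℕ → F →L[ℝ] F →L[ℝ] ℝ} {Alim : F →L[ℝ] F →L[ℝ] ℝ}
    {θ : ℝ} (h : Tendsto A atTop (𝓝 Alim)) (hle : ∀ᶠ n in atTop, ‖A n‖ ≤ θ) : ‖Alim‖ ≤ θ :=
  le_of_tendsto ((continuous_norm.tendsto Alim).comp h) hle

end Limits

namespace Spacetime

variable {𝓢ₙ : ℕ → Spacetime.{u} 4} {pₙ : ∀ n, (𝓢ₙ n).carrier} {O : Opens E4}

/-- **Local Cheeger–Gromov compactness for charts good on an exhaustion** (module docstring).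
[cite: Petersen2006, Ch. 10 §3.2] -/
theorem exists_nearMinkowskiChart_subconvergesLocallyTo_of_exhaustion (hO : IsConnected (O : Set E4))
    {y₀ : E4} (hy₀ : y₀ ∈ (O : Set E4)) (W : ℕ → Opens E4)
    (hWO : ∀ n, (W n : Set E4) ⊆ (O : Set E4)) (hWm : Monotone W)
    (hWc : ∀ n, IsPreconnected (W n : Set E4)) (hW0 : y₀ ∈ (W 0 : Set E4))
    (hWU : ∀ y ∈ (O : Set E4), ∃ n, y ∈ (W n : Set E4)) (Ψ : ∀ n, O → (𝓢ₙ n).carrier)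
    (hΨ : ∀ n, ContMDiffOn 𝓘(ℝ, E4) (𝓡 4) ∞ (Ψ n) (Subtype.val ⁻¹' (W n : Set E4)))
    (hinj : ∀ n, InjOn (Ψ n) (Subtype.val ⁻¹' (W n : Set E4)))
    (hcentre : ∀ n, Ψ n ⟨y₀, hy₀⟩ = pₙ n)
    (hfut : ∀ n, (𝓢ₙ n).timeOrientation.IsFutureDirected
      (mfderiv 𝓘(ℝ, E4) (𝓡 4) (Ψ n) ⟨y₀, hy₀⟩ (E4.basisVector 0)))
    {θ : ℝ} (hθ : θ < 1)
    (hpinch : ∀ n, ∀ y ∈ (W n : Set E4),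
      ‖(𝓢ₙ n).deviationExtend (Minkowski.backgroundOn O) (Ψ n) y‖ ≤ θ)
    (hbound : ∀ k : ℕ, ∃ Λ : ℝ≥0∞, Λ ≠ ⊤ ∧
      ∀ n, supCkENorm (W n : Set E4) k ((𝓢ₙ n).deviationExtend (Minkowski.backgroundOn O) (Ψ n)) ≤ Λ) :
    ∃ (L : NearMinkowskiChart O) (φ : ℕ → ℕ), StrictMono φ ∧
      (∀ y ∈ (O : Set E4), ‖L.G y - Minkowski.bilin‖ ≤ θ) ∧
      (∀ (k : ℕ) (C : ℝ≥0∞), (∀ n, supCkENorm (W n : Set E4) k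
          ((𝓢ₙ n).deviationExtend (Minkowski.backgroundOn O) (Ψ n)) ≤ C) →
        supCkENorm (O : Set E4) k (L.G - fun _ ↦ Minkowski.bilin) ≤ C) ∧
      (∀ (k : ℕ), ∀ K ⊆ (O : Set E4), IsCompact K →
        Tendsto (fun j ↦ supCkENorm K k
          ((𝓢ₙ (φ j)).deviationExtend (Minkowski.backgroundOn O) (Ψ (φ j)) -
            (L.G - fun _ ↦ Minkowski.bilin))) atTop (𝓝 0)) ∧
      ∀ k : ℕ, SubconvergesLocallyTo 𝓢ₙ pₙ (L.spacetime hO) ⟨y₀, hy₀⟩ k := by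
  let z₀ : O := ⟨y₀, hy₀⟩
  let B : ModelBackground := Minkowski.backgroundOn O
  let M : ℕ → E4 → E4 →L[ℝ] E4 →L[ℝ] ℝ := fun n ↦
    (𝓢ₙ n).metricInCoords (Ψ n ∘ (chartAt E4 z₀).symm)
  let H : ℕ → E4 → E4 →L[ℝ] E4 →L[ℝ] ℝ := fun n ↦ M n - B.bilin
  have hBb : ∀ y, B.bilin y = Minkowski.bilin := fun _ ↦ rfl
  have hUnion : (⋃ j, (W j : Set E4)) = (O : Set E4) :=
    Subset.antisymm (iUnion_subset hWO) fun y hy ↦ mem_iUnion.2 (hWU y hy)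
  -- smoothness of the components on the good pieces
  have hHs : ∀ n, ContDiffOn ℝ ∞ (H n) (W n : Set E4) := fun n ↦
    ((𝓢ₙ n).contDiffOn_metricInCoords (W n).2
      ((𝓢ₙ n).contMDiffOn_comp_chartAt_symm_of_contMDiffOn B (Ψ n) z₀ (hWO n) (hΨ n))).sub
      contDiffOn_const
  have hHs' : ∀ j n, j ≤ n → ContDiffOn ℝ ∞ (H n) (W j : Set E4) := fun j n hjn ↦
    (hHs n).mono (hWm hjn)
  have hdiff : ∀ n, ∀ y (hy : y ∈ (W n : Set E4)),
      MDifferentiableAt 𝓘(ℝ, E4) (𝓡 4) (Ψ n) ⟨y, hWO n hy⟩ :=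
    fun n y hy ↦ (𝓢ₙ n).mdifferentiableAt_of_contMDiffOn_preimage B (Ψ n) (W n).2 (hΨ n) (hWO n hy) hy
  have hHeq : ∀ n, ∀ y ∈ (W n : Set E4), H n y = (𝓢ₙ n).deviationExtend B (Ψ n) y := by
    intro n y hy
    have h1 := (𝓢ₙ n).metricInCoords_comp_chartAt_symm_sub_eq_deviation B (Ψ n) z₀ (hWO n hy)
      (hdiff n y hy)
    rw [← (𝓢ₙ n).deviationExtend_coe B (Ψ n) ⟨y, hWO n hy⟩] at h1
    exact h1
  have hHgerm : ∀ n, ∀ y ∈ (W n : Set E4), H n =ᶠ[𝓝 y] (𝓢ₙ n).deviationExtend B (Ψ n) := by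
    intro n y hy
    filter_upwards [(W n).2.mem_nhds hy] with z hz
    exact hHeq n z hz
  have hHsup : ∀ n (K : Set E4), K ⊆ (W n : Set E4) → ∀ k,
      supCkENorm K k (H n) = supCkENorm K k ((𝓢ₙ n).deviationExtend B (Ψ n)) :=
    fun n K hK k ↦ supCkENorm_congr fun y hy ↦ hHgerm n y (hK hy)
  -- eventual uniform bounds on every derivative on compacts of the pieces
  have hb : ∀ (j i : ℕ), ∀ K ⊆ (W j : Set E4), IsCompact K →
      ∃ Λ : ℝ, ∀ n, j ≤ n → ∀ z ∈ K, ‖iteratedFDeriv ℝ i (H n) z‖ ≤ Λ := by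
    intro j i K hKW _
    obtain ⟨Λ, hΛ, hΛb⟩ := hbound i
    refine ⟨Λ.toReal, fun n hjn z hz ↦ ?_⟩
    have hKn : K ⊆ (W n : Set E4) := hKW.trans (hWm hjn)
    have hle : supCkENorm K i (H n) ≤ Λ :=
      ((hHsup n K hKn i).trans_le (supCkENorm_mono hKn _ _)).trans (hΛb n)
    exact (norm_iteratedFDeriv_le_toReal_supCkENorm le_rfl hz (H n)
      (ne_top_of_le_ne_top hΛ hle)).trans (ENNReal.toReal_mono hΛ hle)
  -- the `C^∞` Arzelà–Ascoli extraction on the exhaustion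
  obtain ⟨Hlim, φ, hφ, hHlim', hev'⟩ :=
    exists_strictMono_contDiffOn_infty_tendstoUniformlyOn_iteratedFDeriv_of_exhaustion
      (U := fun j ↦ (W j : Set E4)) (fun j ↦ (W j).2) (fun j j' h ↦ hWm h) hHs' hb
  have hHlim : ContDiffOn ℝ ∞ Hlim O := by rw [← hUnion]; exact hHlim'
  have hev : ∀ (i : ℕ), ∀ K ⊆ (O : Set E4), IsCompact K → TendstoUniformlyOn
      (fun n ↦ iteratedFDeriv ℝ i (H (φ n))) (iteratedFDeriv ℝ i Hlim) atTop K :=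
    fun i K hKO hK ↦ hev' i K (by rw [hUnion]; exact hKO) hK
  -- a compact part of `O` lies in the good pieces of all late enough members of the subsequence
  have hKW : ∀ K ⊆ (O : Set E4), IsCompact K → ∃ j₀, ∀ j, j₀ ≤ j → K ⊆ (W (φ j) : Set E4) := by
    intro K hKO hK
    obtain ⟨j₀, hj₀⟩ := exists_subset_of_isCompact_of_monotone (U := fun j ↦ (W j : Set E4))
      (fun j ↦ (W j).2) (fun j j' h ↦ hWm h) hK (by rw [hUnion]; exact hKO)
    exact ⟨j₀, fun j hj ↦ hj₀.trans (hWm (hj.trans (hφ.id_le j)))⟩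
  have hconv : ∀ (k : ℕ), ∀ K ⊆ (O : Set E4), IsCompact K →
      Tendsto (fun j ↦ supCkENorm K k (H (φ j) - Hlim)) atTop (𝓝 0) := by
    intro k K hKO hK
    obtain ⟨j₀, hj₀⟩ := hKW K hKO hK
    have hat : ∀ j, ∀ x ∈ K, ContDiffAt ℝ k (H (φ (j + j₀))) x := fun j x hx ↦
      (((hHs (φ (j + j₀))).of_le (by exact_mod_cast le_top)).contDiffAt
        ((W _).2.mem_nhds (hj₀ _ (Nat.le_add_left _ _) hx)))
    have hlat : ∀ x ∈ K, ContDiffAt ℝ k Hlim x := fun x hx ↦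
      (hHlim.of_le (by exact_mod_cast le_top)).contDiffAt (O.2.mem_nhds (hKO hx))
    have hev' : ∀ ε > 0, ∀ᶠ j in atTop, ∀ i, i ≤ k → ∀ x ∈ K,
        ‖iteratedFDeriv ℝ i (H (φ (j + j₀))) x - iteratedFDeriv ℝ i Hlim x‖ < ε := by
      intro ε hε
      have h : ∀ i ∈ Finset.range (k + 1), ∀ᶠ j in atTop, ∀ x ∈ K,
          ‖iteratedFDeriv ℝ i (H (φ (j + j₀))) x - iteratedFDeriv ℝ i Hlim x‖ < ε := fun i _ ↦ by
        have hu : TendstoUniformlyOn (fun j ↦ iteratedFDeriv ℝ i (H (φ (j + j₀))))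
            (iteratedFDeriv ℝ i Hlim) atTop K :=
          tendstoUniformlyOn_of_eventually_eq_comp (G := fun n ↦ iteratedFDeriv ℝ i (H n)) (φ := φ)
            (ρ := fun j ↦ j + j₀) (fun a b hab ↦ Nat.add_lt_add_right hab j₀)
            (Eventually.of_forall fun _ ↦ rfl) (hev i K hKO hK)
        rw [Metric.tendstoUniformlyOn_iff] at hu
        filter_upwards [hu ε hε] with j hj x hx
        rw [← dist_eq_norm, dist_comm]
        exact hj x hx
      filter_upwards [(Finset.eventually_all (Finset.range (k + 1))).2 h] with j hj i hi x hx
      exact hj i (Finset.mem_range.2 (Nat.lt_succ_of_le hi)) x hx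
    have h := tendsto_supCkENorm_sub_of_eventually_lt hat hlat hev'
    exact (tendsto_add_atTop_iff_nat j₀).1 h
  -- pointwise convergence on `O`
  have hpt : ∀ y ∈ (O : Set E4), Tendsto (fun j ↦ H (φ j) y) atTop (𝓝 (Hlim y)) := by
    intro y hy
    obtain ⟨j₀, hj₀⟩ := hKW {y} (singleton_subset_iff.2 hy) isCompact_singleton
    have h := tendsto_apply_of_tendsto_supCkENorm (k := 0) (mem_singleton y)
      (fun j ↦ ((hHs (φ (j + j₀))).of_le (by exact_mod_cast le_top)).contDiffAt
        ((W _).2.mem_nhds (hj₀ _ (Nat.le_add_left _ _) (mem_singleton y))))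
      ((hHlim.of_le (by exact_mod_cast le_top)).contDiffAt (O.2.mem_nhds hy))
      ((hconv 0 {y} (singleton_subset_iff.2 hy) isCompact_singleton).comp (tendsto_add_atTop_nat j₀))
    exact (tendsto_add_atTop_iff_nat j₀).1 h
  -- the limit field `G = Hlim + η`
  let G : E4 → E4 →L[ℝ] E4 →L[ℝ] ℝ := fun y ↦ Hlim y + Minkowski.bilin
  have hGs : ContDiffOn ℝ ∞ G O := hHlim.add contDiffOn_const
  have hGsub : ∀ y, G y - Minkowski.bilin = Hlim y := fun y ↦ by
    ext v w
    simp only [G, sub_apply, add_apply]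
    ring
  have hHsymm : ∀ n, ∀ y (v w : E4), H n y v w = H n y w v := fun n y v w ↦ by
    simp only [H, M, Pi.sub_apply, sub_apply, hBb]
    rw [(𝓢ₙ n).metricInCoords_symm _ y v w, Minkowski.bilin_symm v w]
  have hGsymm : ∀ y ∈ (O : Set E4), ∀ v w : E4, G y v w = G y w v := fun y hy v w ↦ by
    have h := symm_of_tendsto_bilin (hpt y hy) (fun j ↦ hHsymm (φ j) y) v w
    simp only [G, add_apply]
    rw [h, Minkowski.bilin_symm v w]
  have hGpinch : ∀ y ∈ (O : Set E4), ‖G y - Minkowski.bilin‖ ≤ θ := by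
    intro y hy
    rw [hGsub y]
    obtain ⟨j₀, hj₀⟩ := hKW {y} (singleton_subset_iff.2 hy) isCompact_singleton
    refine norm_le_of_tendsto_of_eventually (hpt y hy) ?_
    filter_upwards [eventually_ge_atTop j₀] with j hj
    rw [hHeq (φ j) y (hj₀ j hj (mem_singleton y))]
    exact hpinch (φ j) y (hj₀ j hj (mem_singleton y))
  let L : NearMinkowskiChart O :=
    { G := G
      contDiffOn := hGs
      symm := hGsymm
      norm_sub_lt := fun y hy ↦ (hGpinch y hy).trans_lt hθ }
  -- convergence of the components to `G` and of the deviations to `G − η`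
  have hGH : ∀ j, M (φ j) - G = H (φ j) - Hlim := fun j ↦ by
    funext y
    ext v w
    simp only [H, G, Pi.sub_apply, sub_apply, add_apply, hBb]
    ring
  have hconvG : ∀ (k : ℕ), ∀ K ⊆ (O : Set E4), IsCompact K →
      Tendsto (fun j ↦ supCkENorm K k (M (φ j) - G)) atTop (𝓝 0) :=
    fun k K hKO hK ↦ (hconv k K hKO hK).congr fun j ↦ by rw [hGH j]
  have hGm : (G - fun _ ↦ Minkowski.bilin) = Hlim := funext fun y ↦ hGsub y
  have hconvDev : ∀ (k : ℕ), ∀ K ⊆ (O : Set E4), IsCompact K →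
      Tendsto (fun j ↦ supCkENorm K k
        ((𝓢ₙ (φ j)).deviationExtend B (Ψ (φ j)) - (G - fun _ ↦ Minkowski.bilin))) atTop (𝓝 0) := by
    intro k K hKO hK
    rw [hGm]
    obtain ⟨j₀, hj₀⟩ := hKW K hKO hK
    refine (hconv k K hKO hK).congr' ?_
    filter_upwards [eventually_ge_atTop j₀] with j hj
    refine supCkENorm_congr fun y hy ↦ ?_
    exact (hHgerm (φ j) y (hj₀ j hj hy)).sub EventuallyEq.rfl
  -- inherited bounds
  have hbd : ∀ (k : ℕ) (C : ℝ≥0∞), (∀ n, supCkENorm (W n : Set E4) k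
      ((𝓢ₙ n).deviationExtend B (Ψ n)) ≤ C) →
      supCkENorm (O : Set E4) k (G - fun _ ↦ Minkowski.bilin) ≤ C := by
    intro k C hC
    rw [hGm]
    refine supCkENorm_le_of_forall_le fun m hm z hz ↦ ?_
    obtain ⟨j₀, hj₀⟩ := hKW {z} (singleton_subset_iff.2 hz) isCompact_singleton
    have ht : Tendsto (fun j ↦ iteratedFDeriv ℝ m (H (φ (j + j₀))) z) atTop
        (𝓝 (iteratedFDeriv ℝ m Hlim z)) :=
      tendsto_iteratedFDeriv_of_tendsto_supCkENorm hm (mem_singleton z)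
        (fun j ↦ ((hHs (φ (j + j₀))).of_le (by exact_mod_cast le_top)).contDiffAt
          ((W _).2.mem_nhds (hj₀ _ (Nat.le_add_left _ _) (mem_singleton z))))
        ((hHlim.of_le (by exact_mod_cast le_top)).contDiffAt (O.2.mem_nhds hz))
        ((hconv k {z} (singleton_subset_iff.2 hz) isCompact_singleton).comp (tendsto_add_atTop_nat j₀))
    refine le_of_tendsto' ((continuous_enorm.tendsto _).comp ht) fun j ↦ ?_
    have hzW : z ∈ (W (φ (j + j₀)) : Set E4) := hj₀ _ (Nat.le_add_left _ _) (mem_singleton z)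
    calc ‖iteratedFDeriv ℝ m (H (φ (j + j₀))) z‖ₑ
        ≤ supCkENorm ({z} : Set E4) k (H (φ (j + j₀))) :=
          enorm_iteratedFDeriv_le_supCkENorm hm (mem_singleton z) _
      _ = supCkENorm ({z} : Set E4) k ((𝓢ₙ (φ (j + j₀))).deviationExtend B (Ψ (φ (j + j₀)))) :=
          hHsup _ {z} (singleton_subset_iff.2 hzW) k
      _ ≤ supCkENorm (W (φ (j + j₀)) : Set E4) k
            ((𝓢ₙ (φ (j + j₀))).deviationExtend B (Ψ (φ (j + j₀)))) :=
          supCkENorm_mono (singleton_subset_iff.2 hzW) _ _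
      _ ≤ C := hC _
  refine ⟨L, φ, hφ, hGpinch, hbd, hconvDev, fun k ↦ ?_⟩
  exact SubconvergesLocallyTo.ofChartsExhaustion hO hy₀ W hWO hWm hWc hW0 hWU Ψ hΨ hinj hcentre hfut
    (fun n y hy ↦ (hpinch n y hy).trans_lt hθ) L hφ (hconvG k)

/-- **Deviation form ⇒ components form of the convergence, eventually**, for charts good on an
exhaustion: if the deviations `Ψ_{φ j}^* g − η` converge to `G − η` in `Cᵏ` on a compact `K` of the
domain, so do the components `metricInCoords (Ψ_{φ j} ∘ (chartAt E4 x).symm)` to `G` (they have the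
same germs on the good pieces, which contain `K` for `j` large). [folklore] -/
theorem tendsto_supCkENorm_metricInCoords_sub_of_deviationExtend_exhaustion
    {Ψ : ∀ n, O → (𝓢ₙ n).carrier} (W : ℕ → Opens E4) (hWO : ∀ n, (W n : Set E4) ⊆ (O : Set E4))
    (hWm : Monotone W) (hWU : ∀ y ∈ (O : Set E4), ∃ n, y ∈ (W n : Set E4))
    (hΨ : ∀ n, ContMDiffOn 𝓘(ℝ, E4) (𝓡 4) ∞ (Ψ n) (Subtype.val ⁻¹' (W n : Set E4)))
    (x : O) (G : E4 → E4 →L[ℝ] E4 →L[ℝ] ℝ) {φ : ℕ → ℕ} (hφ : StrictMono φ) {k : ℕ} {K : Set E4}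
    (hKO : K ⊆ (O : Set E4)) (hK : IsCompact K)
    (hlim : Tendsto (fun m ↦ supCkENorm K k
      ((𝓢ₙ (φ m)).deviationExtend (Minkowski.backgroundOn O) (Ψ (φ m)) -
        (G - fun _ ↦ Minkowski.bilin))) atTop (𝓝 0)) :
    Tendsto (fun m ↦ supCkENorm K k
      ((𝓢ₙ (φ m)).metricInCoords (Ψ (φ m) ∘ (chartAt E4 x).symm) - G)) atTop (𝓝 0) := by
  have hUnion : (⋃ j, (W j : Set E4)) = (O : Set E4) :=
    Subset.antisymm (iUnion_subset hWO) fun y hy ↦ mem_iUnion.2 (hWU y hy)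
  obtain ⟨j₀, hj₀⟩ := LocalSubconvergence.exists_subset_of_isCompact_of_monotone_opens hWm hK
    (by rw [hUnion]; exact hKO)
  have hKW : ∀ j, j₀ ≤ j → K ⊆ (W (φ j) : Set E4) := fun j hj ↦
    hj₀.trans (hWm (hj.trans (hφ.id_le j)))
  refine hlim.congr' ?_
  filter_upwards [eventually_ge_atTop j₀] with m hm
  refine supCkENorm_congr fun y hy ↦ ?_
  filter_upwards [(W (φ m)).2.mem_nhds (hKW m hm hy)] with z hz
  have hzO : z ∈ (O : Set E4) := hWO _ hz
  have hd : MDifferentiableAt 𝓘(ℝ, E4) (𝓡 4) (Ψ (φ m)) ⟨z, hzO⟩ :=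
    (𝓢ₙ (φ m)).mdifferentiableAt_of_contMDiffOn_preimage (Minkowski.backgroundOn O) (Ψ (φ m))
      (W (φ m)).2 (hΨ _) hzO hz
  have h1 := (𝓢ₙ (φ m)).metricInCoords_comp_chartAt_symm_sub_eq_deviation (Minkowski.backgroundOn O)
    (Ψ (φ m)) x hzO hd
  have h2 : (𝓢ₙ (φ m)).deviationExtend (Minkowski.backgroundOn O) (Ψ (φ m)) z =
      (𝓢ₙ (φ m)).deviation (Minkowski.backgroundOn O) (Ψ (φ m)) ⟨z, hzO⟩ :=
    (𝓢ₙ (φ m)).deviationExtend_coe (Minkowski.backgroundOn O) (Ψ (φ m)) ⟨z, hzO⟩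
  show (𝓢ₙ (φ m)).deviationExtend (Minkowski.backgroundOn O) (Ψ (φ m)) z - (G z - Minkowski.bilin) =
    (𝓢ₙ (φ m)).metricInCoords (Ψ (φ m) ∘ (chartAt E4 x).symm) z - G z
  rw [h2, ← h1]
  ext v w
  simp only [sub_apply]
  show (𝓢ₙ (φ m)).metricInCoords (Ψ (φ m) ∘ (chartAt E4 x).symm) z v w - Minkowski.bilin v w -
      (G z v w - Minkowski.bilin v w) =
    (𝓢ₙ (φ m)).metricInCoords (Ψ (φ m) ∘ (chartAt E4 x).symm) z v w - G z v w
  ring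

/-- **Local Cheeger–Gromov compactness on an exhaustion, with far charts**: under the hypotheses of
`exists_nearMinkowskiChart_subconvergesLocallyTo_of_exhaustion` for charts on the domain of a model
background `B`, the limit is a pointed `Cᵏ_loc` limit WITH FAR CHARTS `Ψₙ → id` relative to `B`,
for every `k`. [cite: Petersen2006, Ch. 10 §3.2] -/
theorem exists_nearMinkowskiChart_subconvergesLocallyWithFarChartsTo_of_exhaustion
    {𝓢ₙ : ℕ → Spacetime.{u} 4} {pₙ : ∀ n, (𝓢ₙ n).carrier} (B : ModelBackground)
    (hO : IsConnected (B.domain : Set E4)) {y₀ : E4} (hy₀ : y₀ ∈ (B.domain : Set E4))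
    (W : ℕ → Opens E4) (hWO : ∀ n, (W n : Set E4) ⊆ (B.domain : Set E4)) (hWm : Monotone W)
    (hWc : ∀ n, IsPreconnected (W n : Set E4)) (hW0 : y₀ ∈ (W 0 : Set E4))
    (hWU : ∀ y ∈ (B.domain : Set E4), ∃ n, y ∈ (W n : Set E4))
    (Ψ : ∀ n, B.domain → (𝓢ₙ n).carrier)
    (hΨ : ∀ n, ContMDiffOn 𝓘(ℝ, E4) (𝓡 4) ∞ (Ψ n) (Subtype.val ⁻¹' (W n : Set E4)))
    (hinj : ∀ n, InjOn (Ψ n) (Subtype.val ⁻¹' (W n : Set E4)))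
    (hcentre : ∀ n, Ψ n ⟨y₀, hy₀⟩ = pₙ n)
    (hfut : ∀ n, (𝓢ₙ n).timeOrientation.IsFutureDirected
      (mfderiv 𝓘(ℝ, E4) (𝓡 4) (Ψ n) ⟨y₀, hy₀⟩ (E4.basisVector 0)))
    {θ : ℝ} (hθ : θ < 1)
    (hpinch : ∀ n, ∀ y ∈ (W n : Set E4),
      ‖(𝓢ₙ n).deviationExtend (Minkowski.backgroundOn B.domain) (Ψ n) y‖ ≤ θ)
    (hbound : ∀ k : ℕ, ∃ Λ : ℝ≥0∞, Λ ≠ ⊤ ∧ ∀ n, supCkENorm (W n : Set E4) k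
      ((𝓢ₙ n).deviationExtend (Minkowski.backgroundOn B.domain) (Ψ n)) ≤ Λ) :
    ∃ (L : NearMinkowskiChart B.domain) (φ : ℕ → ℕ), StrictMono φ ∧
      (∀ y ∈ (B.domain : Set E4), ‖L.G y - Minkowski.bilin‖ ≤ θ) ∧
      (∀ (k : ℕ) (C : ℝ≥0∞), (∀ n, supCkENorm (W n : Set E4) k
          ((𝓢ₙ n).deviationExtend (Minkowski.backgroundOn B.domain) (Ψ n)) ≤ C) →
        supCkENorm (B.domain : Set E4) k (L.G - fun _ ↦ Minkowski.bilin) ≤ C) ∧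
      (∀ (k : ℕ), ∀ K ⊆ (B.domain : Set E4), IsCompact K →
        Tendsto (fun j ↦ supCkENorm K k
          ((𝓢ₙ (φ j)).deviationExtend (Minkowski.backgroundOn B.domain) (Ψ (φ j)) -
            (L.G - fun _ ↦ Minkowski.bilin))) atTop (𝓝 0)) ∧
      ∀ k : ℕ, SubconvergesLocallyWithFarChartsTo 𝓢ₙ pₙ (L.spacetime hO) ⟨y₀, hy₀⟩ k B Ψ
        (id : B.domain → (L.spacetime hO).carrier) := by
  obtain ⟨L, φ, hφ, h1, h2, h3, -⟩ := exists_nearMinkowskiChart_subconvergesLocallyTo_of_exhaustion hO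
    hy₀ W hWO hWm hWc hW0 hWU Ψ hΨ hinj hcentre hfut hθ hpinch hbound
  refine ⟨L, φ, hφ, h1, h2, h3, fun k ↦ ?_⟩
  exact SubconvergesLocallyWithFarChartsTo.ofChartsExhaustion B hO hy₀ W hWO hWm hWc hW0 hWU Ψ hΨ hinj
    hcentre hfut (fun n y hy ↦ (hpinch n y hy).trans_lt hθ) L hφ fun K hKO hK ↦
      tendsto_supCkENorm_metricInCoords_sub_of_deviationExtend_exhaustion W hWO hWm hWU hΨ ⟨y₀, hy₀⟩
        L.G hφ hKO hK (h3 k K hKO hK)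

end Spacetime

end Literature.Geometry.Lorentzian

end
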